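import Literature.AlgebraicGeometry.Frobenioids.ModelFrobenioidRationallyStandardProofs
import Literature.AlgebraicGeometry.Frobenioids.Prop55SubRatStdSlot
import HarnessLib

/-!
# Frobenioids I, Theorem 5.2 (iii) — the two named statements AT THE Def. 4.5 (iii) parameters

Mochizuki, *The geometry of Frobenioids I: the general theory*, Kyushu J. Math. **62** (2008)
293–400, §5, Theorem 5.2 (iii), kurims text p. 101 (proof p. 103)
[cite: MochizukiFrdI2008, Thm. 5.2(iii) p.101]:

  "`C` is of rationally standard type if and only if the following conditions are satisfied:
  (a) `C` is of rational and standard type; (b) `(C^un-tr)^birat` admits a Frobenius-compact object."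

PROOF-ONLY companion (cell abc-iut, D-0079 L-F sub-cell [FrdI/II], pack D rows F-1120 / F-1121 / F-1119 of
`plan/L1/LF-FRD.tsv`; seat abc-iut-w5-d042).  `ModelFrobenioidStandard.lean` (seat abc-iut-L1-t2) types the
second sentence of Thm. 5.2 (iii) twice: as the SCHEMA `ModelFrobenioid.RationallyStandardTypeIff` over three
`Prop`/predicate PARAMETERS (faithful to print only when these are bound to THE constructions), and as its closed
re-binding `ModelFrobenioid.RationallyStandardTypeIff' Φ B DivB R` over the Def. 4.5 (iii) interface `R`.
`ModelFrobenioidRationallyStandardProofs.lean` (seat abc-iut-L1-d10 / L1-t2) proves the latter for every `R`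
whose birationalization datum `R.B` is THE birationalization `C → C^birat` of Prop. 4.4.  Here both named
statements are recorded AT THE parameters `PreFrobenioid.rsParams hF Supp` of `Prop55Sub.lean` (seat
abc-iut-w4-d084: `C^birat` = THE birationalization, the operations of `C^un-tr` = those of ITS structure functor,
`(C^un-tr)^birat` = THE birationalization of the Frobenioid `C^un-tr`; only the support predicate `Supp` of
Def. 2.4 (i)(d) is a datum, and print's own `Supp` is `PrimarySupp`), so that the conclusion heads are literally
the two FACT declarations with no side condition left:

* `rationallyStandardTypeIff'_rsParams` / `…_of_hypotheses` / `…_primarySupp` — F-1121 at THE parameters;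
* `rationallyStandardTypeIff_rsParams` — the schema F-1120 with its three parameters bound to THE data of
  `rsParams` (definitionally the previous item);
* `isZeroMonoid_iff_forall_subsingleton`, `isZeroMonoid_const_punit` — the antecedent "`Φ` is the zero monoid"
  of clause (a) (F-1119) is vocabulary: it holds for the zero monoid on any `D` and fails for the constant monoid
  `ℕ` / the arithmetic and geometric divisor monoids (`DegreeModel.not_isZeroMonoid_const`,
  `not_isZeroMonoid_arith`, `not_isZeroMonoid_geom`, already in the tree).

No definition, no new notion; no statement of the paper is restated or strengthened.  [FrdI] is a refereed
prerequisite paper — nothing here bears on [IUTchIII] Cor. 3.12.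
-/

namespace Literature.AlgebraicGeometry.Frobenioids

open CategoryTheory Opposite

universe w v u

namespace ModelFrobenioid

variable {D : Type u} [Category.{v} D] (Φ B : Dᵒᵖ ⥤ CommMonCat.{w}) (DivB : B ⟶ monoidGp Φ)

/-! ### Thm. 5.2 (iii), second sentence, at THE parameters `rsParams` -/

/-- **Thm. 5.2 (iii), second sentence (F-1121) AT THE Def. 4.5 (iii) parameters**: for every Frobenioid
structure `hF` on the model Frobenioid `C → F_Φ` of `(Φ, B, Div_B)` and every support predicate `Supp`
(Def. 2.4 (i)(d)), the named statement `RationallyStandardTypeIff'` holds at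
`R := PreFrobenioid.rsParams hF Supp` — its birationalization datum is THE `C^birat` by construction.
[cite: MochizukiFrdI2008, Thm. 5.2(iii) p.103] -/
theorem rationallyStandardTypeIff'_rsParams (hF : PreFrobenioid.IsFrobenioid (toElem Φ B DivB))
    (Supp : ∀ {X : D}, (data Φ B DivB).Mon X → Primes ((data Φ B DivB).Mon X) → Prop) :
    RationallyStandardTypeIff' Φ B DivB (PreFrobenioid.rsParams hF Supp) :=
  rationallyStandardTypeIff'_biratData Φ B DivB hF _ _ rfl

/-- **Thm. 5.2 (iii), second sentence (F-1121) AT THE parameters formed from the standing hypotheses of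
Thm. 5.2 alone** (`Φ` divisorial on a connected, totally epimorphic `D`, `B` group-like — these make `C` a
Frobenioid, Thm. 5.2 (ii)). [cite: MochizukiFrdI2008, Thm. 5.2(iii) p.103] -/
theorem rationallyStandardTypeIff'_rsParams_of_hypotheses (h : Hypotheses Φ B)
    (Supp : ∀ {X : D}, (data Φ B DivB).Mon X → Primes ((data Φ B DivB).Mon X) → Prop) :
    RationallyStandardTypeIff' Φ B DivB (PreFrobenioid.rsParams (h.isFrobenioid Φ B DivB) Supp) :=
  rationallyStandardTypeIff'_rsParams Φ B DivB _ Supp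

/-- **Thm. 5.2 (iii), second sentence (F-1121), fully closed**: at THE parameters with print's own support
predicate of Def. 2.4 (i)(d) (`PrimarySupp`: "`𝔭 ∈ Supp(a)` iff some primary `a₀` of the class `𝔭` satisfies
`a₀ ≼ a`"). [cite: MochizukiFrdI2008, Thm. 5.2(iii) p.103] -/
theorem rationallyStandardTypeIff'_rsParams_primarySupp (h : Hypotheses Φ B) :
    RationallyStandardTypeIff' Φ B DivB
      (PreFrobenioid.rsParams (h.isFrobenioid Φ B DivB) fun a 𝔭 => PrimarySupp a 𝔭) :=
  rationallyStandardTypeIff'_rsParams Φ B DivB _ _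

/-- **Thm. 5.2 (iii), second sentence — the SCHEMA `RationallyStandardTypeIff` (F-1120) AT THE
constructions**: its three parameters ("`C` is of rationally standard type", "`C` is of rational type",
"Frobenius-compact object of `(C^un-tr)^birat`") bound to THE Def. 4.5 (iii) data
`R := PreFrobenioid.rsParams _ Supp` (Def. 4.5 (iii) over THE birationalizations, every object rational for
`R.B`, `R.Supp` in the sense of Def. 4.5 (ii), Frobenius-compactness in THE `(C^un-tr)^birat`).  With these
bindings the schema IS `RationallyStandardTypeIff'` (definitionally), hence holds.
[cite: MochizukiFrdI2008, Thm. 5.2(iii) p.101] -/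
theorem rationallyStandardTypeIff_rsParams (h : Hypotheses Φ B)
    (Supp : ∀ {X : D}, (data Φ B DivB).Mon X → Primes ((data Φ B DivB).Mon X) → Prop) :
    RationallyStandardTypeIff Φ B DivB
      ((data Φ B DivB).IsOfRationallyStandardType (PreFrobenioid.rsParams (h.isFrobenioid Φ B DivB) Supp))
      (∀ A : ModelFrobenioid Φ B DivB,
        PreFrobenioidData.IsRational (PreFrobenioid.rsParams (h.isFrobenioid Φ B DivB) Supp).B
          (PreFrobenioid.rsParams (h.isFrobenioid Φ B DivB) Supp).Supp A)
      (fun Y : (PreFrobenioid.rsParams (h.isFrobenioid Φ B DivB) Supp).BU.Birat =>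
        (PreFrobenioid.rsParams (h.isFrobenioid Φ B DivB) Supp).BU.ops.IsFrobeniusCompact Y) :=
  rationallyStandardTypeIff'_rsParams_of_hypotheses Φ B DivB h Supp

/-! ### Thm. 5.2 (iii)(a): "`Φ` is the zero monoid" -/

/-- "`Φ` is the zero monoid" (Thm. 5.2 (iii)(a), F-1119) says exactly that every `Φ(A)` is the trivial monoid.
[cite: MochizukiFrdI2008, Thm. 5.2(iii) p.101] -/
theorem isZeroMonoid_iff_forall_subsingleton :
    IsZeroMonoid Φ ↔ ∀ A : Dᵒᵖ, Subsingleton (Φ.obj A) :=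
  ⟨fun h A => ⟨fun x y => (h A x).trans (h A y).symm⟩, fun h A x => (h A).elim x 1⟩

/-- The zero monoid on `D` (the constant functor at the trivial monoid) IS the zero monoid in the sense of
Thm. 5.2 (iii)(a) (F-1119 at its defining instance; contrast `DegreeModel.not_isZeroMonoid_const`,
`not_isZeroMonoid_arith`, `not_isZeroMonoid_geom` for the monoids `ℕ`, `Φ_{K/F}`, `Φ^geom`).
[cite: MochizukiFrdI2008, Thm. 5.2(iii) p.101] -/
theorem isZeroMonoid_const_punit :
    IsZeroMonoid ((Functor.const Dᵒᵖ).obj (CommMonCat.of PUnit.{w + 1})) :=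
  fun _ _ => rfl

end ModelFrobenioid

end Literature.AlgebraicGeometry.Frobenioids
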